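import Mathlib
import HarnessLib
import Summits.PneNP.PneNP.Theorems.AeaCutRectanglesSparseWitnesses

/-!
# Crux `FoolingMeasure` (stmt-PneNP-19727): SPARSE SUPPORTS CANNOT FOOL (two refuted weakenings)

Negative lemmas of the lead prover (pnp-aea-p1 g2, 2026-08-27) for the crux X1
`Summit.PneNP.PneNP.Theses.AeaCutRectangles.FoolingMeasure` of route `AeaCutRectangles`, in the style of
`AeaCutRectanglesOrbitMeasures.foolingMeasure_false_for_orbitMeasures`: X1's statement with its construction
space ("∃ μ, probability measure on loopless non-3-colourable edge sets") RESTRICTED by one extra support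
clause, and the restricted statement REFUTED.  Engine: `AeaCutRectanglesSparseWitnesses` (superset
rectangles, sparse fibres, the count `(m+1)(n²)^m` against the threshold `n^{-n/2}`).

* **`foolingMeasure_false_for_sparseObstructions`** — supports each containing a non-3-colourable edge set
  with fewer than `n/4` edges (precisely `4(|H|+1) ≤ n`) cannot fool; in particular
  **`foolingMeasure_false_for_K4`** — supports containing a `K₄` cannot fool.  So every X1 support graph is
  `K₄`-free and all its 4-critical subgraphs have `≥ n/4` edges (Stirling in the count: `(1/2 - o(1))·n`);
  this sharpens the line card's N3 ("no split certificate on `≤ log₃ n` vertices", Lines/duty.md) from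
  logarithmic vertex size to linear edge size.
* **`foolingMeasure_false_for_sparseHalf`** — supports each having SOME near-balanced cut (in X1's own
  window) with fewer than `n/4` inside edges cannot fool; in particular
  **`foolingMeasure_false_for_independentHalf`** — supports with an independent near-balanced vertex set
  (independence number `≥ (1/2-ε)·n`) cannot fool.  This is the ADAPTIVE-cut form of WITNESS-g1 §5 (N1),
  which was stated per fixed cut; with Stirling the bound is `> n/2` inside edges in every near-half.

* COUNTING (`card_filter_card_le_choose`: `#{H : |H| ≤ m} ≤ (m+1)·C(N,m)` for `2m ≤ N`; `le_card_sym2_fin`), the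
  sharp form of the count, used (with the tree's Stirling bound `C(N,m) ≤ (eN/m)^m`) by the conditional
  refutation `FoolingMeasure/Negative/FoolingMeasureFalseOfHalfSparseCore`.

Reading for the crux (analysis `Cruxes/FoolingMeasure/Lines/duty-analysis-g2.md`): an X1 support graph must
be `K₄`-free with all critical subgraphs linear, have independence number `< (1/2-ε)n` and `> n/4` (`> n/2`)
edges inside EVERY near-balanced vertex set, while BOTH sides of every near-balanced cut stay 3-colourable
(one-sided rectangles) and both carry min-entropy `≥ (n/2)·log₂ n + C·n` (`AeaCutRectanglesFibreBound`,
`AeaCutRectanglesOrbitMeasures`).  For random-like supports "no sparse half" and "no non-3-colourable half"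
conflict (the no-window computation of the analysis); 4-critical supports pass the colourability tests for
free but the known dense ones (Toft) have sparse near-halves and low-entropy interfaces.

HONEST FRAMING: elementary counting (union bounds over `≤ 2^n·n^{n/2-1}` cheap rectangles); FRONTIER
material for a rung of Fagin's complement ladder (NON-3-COL vs ESO(∀∃∀)); a restricted-model witness —
nothing here bears on P vs NP.
-/

set_option linter.dupNamespace false
set_option autoImplicit false

namespace Summit.PneNP.PneNP.Theorems.AeaCutRectanglesNoSparseSupports

open Finset
open Summit.PneNP.PneNP.Theorems.AeaCutRectanglesDutyRectangles
open Summit.PneNP.PneNP.Theorems.AeaCutRectanglesSparseWitnesses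

/-! ### Counting (used by `FoolingMeasure/Negative/FoolingMeasureFalseOfHalfSparseCore`): `#{H : |H| ≤ m} ≤ (m+1)·C(N,m)` -/

/-- A finite type with `N ≥ 2m` elements has at most `(m+1)·C(N,m)` subsets of size `≤ m`. -/
theorem card_filter_card_le_choose (α : Type*) [Fintype α] [DecidableEq α] (m : ℕ)
    (hm : 2 * m ≤ Fintype.card α) :
    ((univ : Finset (Finset α)).filter (fun s => s.card ≤ m)).card ≤
      (m + 1) * (Fintype.card α).choose m := by
  -- binomial coefficients increase up to the middle (folklore; cf. `choose_mono_left_half` elsewhere in the tree)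
  have hmono : ∀ j m' : ℕ, j ≤ m' → 2 * m' ≤ Fintype.card α →
      (Fintype.card α).choose j ≤ (Fintype.card α).choose m' := by
    intro j m' hjm hm'
    induction m', hjm using Nat.le_induction with
    | base => exact le_rfl
    | succ k hjk ih =>
        exact (ih (by omega)).trans (Nat.choose_le_succ_of_lt_half_left (by omega))
  have hsub : (univ : Finset (Finset α)).filter (fun s => s.card ≤ m) ⊆
      (range (m + 1)).biUnion (fun j => powersetCard j (univ : Finset α)) := by
    intro s hs
    rw [mem_biUnion]
    exact ⟨s.card, mem_range.2 (Nat.lt_succ_of_le (mem_filter.1 hs).2),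
      mem_powersetCard.2 ⟨subset_univ _, rfl⟩⟩
  calc ((univ : Finset (Finset α)).filter (fun s => s.card ≤ m)).card
      ≤ ((range (m + 1)).biUnion (fun j => powersetCard j (univ : Finset α))).card := card_le_card hsub
    _ ≤ ∑ j ∈ range (m + 1), (powersetCard j (univ : Finset α)).card := card_biUnion_le
    _ ≤ ∑ _j ∈ range (m + 1), (Fintype.card α).choose m := by
        refine sum_le_sum fun j hj => ?_
        rw [card_powersetCard, card_univ]
        exact hmono j m (Nat.lt_succ_iff.1 (mem_range.1 hj)) hm
    _ = (m + 1) * (Fintype.card α).choose m := by rw [sum_const, card_range, smul_eq_mul]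


/-- `n ≤ |Sym2 (Fin n)|` for `n ≥ 1`. -/
theorem le_card_sym2_fin {n : ℕ} (hn : 1 ≤ n) : n ≤ Fintype.card (Sym2 (Fin n)) := by
  rw [Sym2.card, Fintype.card_fin, Nat.choose_two_right, Nat.add_sub_cancel]
  apply (Nat.le_div_iff_mul_le (by norm_num)).2
  nlinarith

/-! ### X1 restricted to supports with a sparse obstruction is false -/

/-- **Sparse obstructions cannot be fooled.**  The weakening of the construction space of
`Summit.PneNP.PneNP.Theses.AeaCutRectangles.FoolingMeasure` to measures each of whose support graphs
CONTAINS A NON-3-COLOURABLE EDGE SET WITH FEWER THAN `n/4` EDGES (precisely `4(|H|+1) ≤ n`) makes the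
statement FALSE: at `C = 0`, for every large `n`, the `≤ n·n^{2(n/4-1)} < n^{n/2}` superset rectangles over
the cut `{0,…,⌊n/2⌋-1}` would carry the whole mass.  Hence every X1 support graph has all its non-3-colourable
(equivalently: 4-critical) subgraphs of size `≥ n/4` edges — no `K₄`, no odd wheel, no bounded or sublinear
critical configuration anywhere (Stirling in the count gives `(1/2 - o(1))·n` edges). -/
theorem foolingMeasure_false_for_sparseObstructions :
    ¬ ∃ ε : ℝ, 0 < ε ∧ ε ≤ 1 / 4 ∧ ∀ C : ℕ, ∃ᶠ n in Filter.atTop, ∃ μ : Finset (Sym2 (Fin n)) → ℝ,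
      (∀ S, 0 ≤ μ S) ∧ (∑ S, μ S = 1) ∧
      (∀ S, μ S ≠ 0 → (∀ e ∈ S, ¬ e.IsDiag) ∧
        ¬ (SimpleGraph.fromEdgeSet (S : Set (Sym2 (Fin n)))).Colorable 3) ∧
      (∀ S, μ S ≠ 0 → ∃ H, H ⊆ S ∧ 4 * (H.card + 1) ≤ n ∧
        ¬ (SimpleGraph.fromEdgeSet (H : Set (Sym2 (Fin n)))).Colorable 3) ∧
      ∀ B : Finset (Fin n), (1 / 2 - ε) * (n : ℝ) ≤ B.card → (B.card : ℝ) ≤ (1 / 2 + ε) * n →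
        ∀ 𝓐 𝓑 : Finset (Finset (Sym2 (Fin n))),
          (∀ α ∈ 𝓐, ∀ e ∈ α, ¬ e.IsDiag ∧ ∃ v ∈ e, v ∉ B) →
          (∀ β ∈ 𝓑, ∀ e ∈ β, ¬ e.IsDiag ∧ ∀ v ∈ e, v ∈ B) →
          (∀ α ∈ 𝓐, ∀ β ∈ 𝓑,
            ¬ (SimpleGraph.fromEdgeSet ((α ∪ β : Finset (Sym2 (Fin n))) : Set (Sym2 (Fin n)))).Colorable 3) →
          ∑ q ∈ 𝓐 ×ˢ 𝓑, μ (q.1 ∪ q.2) ≤ (2 : ℝ) ^ (-((n : ℝ) / 2 * Real.logb 2 n) - (C : ℝ) * n) := by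
  rintro ⟨ε, hε0, -, hC⟩
  obtain ⟨N, hN⟩ := exists_nat_gt (1 / ε)
  obtain ⟨n, hnN, μ, hμ, hsum, hs, hrestr, hX⟩ := Filter.frequently_atTop.1 (hC 0) (N + 4)
  have hn4 : 4 ≤ n := by omega
  have hnε : (1 : ℝ) ≤ ε * n := by
    have hNn : (N : ℝ) ≤ n := by exact_mod_cast (show N ≤ n by omega)
    have h := mul_le_mul_of_nonneg_left hNn hε0.le
    have h' : 1 < ε * N := by
      rw [div_lt_iff₀ hε0] at hN
      linarith
    linarith
  -- the cut: the first ⌊n/2⌋ vertices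
  set b : ℕ := n / 2 with hb
  have hblt : b < n := by omega
  set B : Finset (Fin n) := Finset.Iio (⟨b, hblt⟩ : Fin n) with hB
  have hBcard : B.card = b := by rw [hB, Fin.card_Iio]
  have h2b : 2 * b ≤ n := by omega
  have hwin1 : (1 / 2 - ε) * (n : ℝ) ≤ B.card := by
    rw [hBcard]
    have : (n : ℝ) ≤ 2 * (b : ℝ) + 1 := by exact_mod_cast (show n ≤ 2 * b + 1 by omega)
    nlinarith
  have hwin2 : (B.card : ℝ) ≤ (1 / 2 + ε) * n := by
    rw [hBcard]
    have : 2 * (b : ℝ) ≤ n := by exact_mod_cast h2b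
    nlinarith
  have hclause := hX B hwin1 hwin2
  -- the edge budget
  set m : ℕ := n / 4 - 1 with hm
  have hm4 : 4 * (m + 1) ≤ n := by omega
  have hrestr' : ∀ S, μ S ≠ 0 → ∃ H, H ⊆ S ∧ H.card ≤ m ∧
      ¬ (SimpleGraph.fromEdgeSet (H : Set (Sym2 (Fin n)))).Colorable 3 := by
    intro S hS
    obtain ⟨H, hHS, hc, hH⟩ := hrestr S hS
    exact ⟨H, hHS, by omega, hH⟩
  have htot := total_le_of_sparseObstructions μ hμ hs hclause m hrestr'
  rw [hsum] at htot
  have hδ : (2 : ℝ) ^ (-((n : ℝ) / 2 * Real.logb 2 n) - ((0 : ℕ) : ℝ) * n) =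
      (2 : ℝ) ^ (-((n : ℝ) / 2 * Real.logb 2 n)) := by
    rw [Nat.cast_zero, zero_mul, sub_zero]
  rw [hδ] at htot
  have hpos : (0 : ℝ) < (2 : ℝ) ^ (-((n : ℝ) / 2 * Real.logb 2 n)) := Real.rpow_pos_of_pos (by norm_num) _
  have hcard := card_small_edgeSets_le (show 1 ≤ n by omega) m
  have hlt := count_mul_threshold_lt_one hn4 hm4
  have := mul_le_mul_of_nonneg_right hcard hpos.le
  linarith

/-- **`K₄` supports cannot be fooled.**  X1 restricted to measures each of whose support graphs contains a
`K₄` (four pairwise adjacent vertices) is FALSE — the case `|H| = 6` of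
`foolingMeasure_false_for_sparseObstructions`.  Every X1 support graph is `K₄`-free. -/
theorem foolingMeasure_false_for_K4 :
    ¬ ∃ ε : ℝ, 0 < ε ∧ ε ≤ 1 / 4 ∧ ∀ C : ℕ, ∃ᶠ n in Filter.atTop, ∃ μ : Finset (Sym2 (Fin n)) → ℝ,
      (∀ S, 0 ≤ μ S) ∧ (∑ S, μ S = 1) ∧
      (∀ S, μ S ≠ 0 → (∀ e ∈ S, ¬ e.IsDiag) ∧
        ¬ (SimpleGraph.fromEdgeSet (S : Set (Sym2 (Fin n)))).Colorable 3) ∧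
      (∀ S, μ S ≠ 0 → ∃ a b c d : Fin n, a ≠ b ∧ a ≠ c ∧ a ≠ d ∧ b ≠ c ∧ b ≠ d ∧ c ≠ d ∧
        s(a, b) ∈ S ∧ s(a, c) ∈ S ∧ s(a, d) ∈ S ∧ s(b, c) ∈ S ∧ s(b, d) ∈ S ∧ s(c, d) ∈ S) ∧
      ∀ B : Finset (Fin n), (1 / 2 - ε) * (n : ℝ) ≤ B.card → (B.card : ℝ) ≤ (1 / 2 + ε) * n →
        ∀ 𝓐 𝓑 : Finset (Finset (Sym2 (Fin n))),
          (∀ α ∈ 𝓐, ∀ e ∈ α, ¬ e.IsDiag ∧ ∃ v ∈ e, v ∉ B) →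
          (∀ β ∈ 𝓑, ∀ e ∈ β, ¬ e.IsDiag ∧ ∀ v ∈ e, v ∈ B) →
          (∀ α ∈ 𝓐, ∀ β ∈ 𝓑,
            ¬ (SimpleGraph.fromEdgeSet ((α ∪ β : Finset (Sym2 (Fin n))) : Set (Sym2 (Fin n)))).Colorable 3) →
          ∑ q ∈ 𝓐 ×ˢ 𝓑, μ (q.1 ∪ q.2) ≤ (2 : ℝ) ^ (-((n : ℝ) / 2 * Real.logb 2 n) - (C : ℝ) * n) := by
  rintro ⟨ε, hε0, hε1, hC⟩
  apply foolingMeasure_false_for_sparseObstructions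
  refine ⟨ε, hε0, hε1, fun C => Filter.frequently_atTop.2 fun a => ?_⟩
  obtain ⟨n, hn, μ, hμ, hsum, hs, hK4, hX⟩ := Filter.frequently_atTop.1 (hC C) (max a 28)
  refine ⟨n, le_trans (le_max_left _ _) hn, μ, hμ, hsum, hs, ?_, hX⟩
  intro S hS
  obtain ⟨a', b, c, d, hab, hac, had, hbc, hbd, hcd, h1, h2, h3, h4, h5, h6⟩ := hK4 S hS
  refine ⟨{s(a', b), s(a', c), s(a', d), s(b, c), s(b, d), s(c, d)}, ?_, ?_,
    K4_not_colorable hab hac had hbc hbd hcd⟩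
  · intro e he
    simp only [mem_insert, mem_singleton] at he
    rcases he with rfl | rfl | rfl | rfl | rfl | rfl <;> assumption
  · have hcard : ({s(a', b), s(a', c), s(a', d), s(b, c), s(b, d), s(c, d)} :
        Finset (Sym2 (Fin n))).card ≤ 6 :=
      (card_insert_le _ _).trans (Nat.succ_le_succ <| (card_insert_le _ _).trans (Nat.succ_le_succ <|
        (card_insert_le _ _).trans (Nat.succ_le_succ <| (card_insert_le _ _).trans (Nat.succ_le_succ <|
        (card_insert_le _ _).trans (Nat.succ_le_succ <| (card_singleton _).le)))))
    have h28 : 28 ≤ n := le_trans (le_max_right _ _) hn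
    omega

/-! ### X1 restricted to supports with a sparse near-half is false -/

/-- **Sparse near-halves cannot be fooled.**  The weakening of the construction space of
`Summit.PneNP.PneNP.Theses.AeaCutRectangles.FoolingMeasure` to measures each of whose support graphs has
SOME near-balanced cut `B` (in X1's own window) with fewer than `n/4` edges inside `B` (precisely
`4(|G[B]|+1) ≤ n`) makes the statement FALSE: at `C = 1`, for every large `n`, the `≤ 2^n · n·n^{2(n/4-1)}`
sparse Bob-fibres would carry the whole mass, against the threshold `2^{-n}·n^{-n/2}`.  Hence every X1
support graph carries `≥ n/4` (Stirling: `> n/2`) edges inside EVERY near-balanced vertex set — the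
adaptive-cut form of WITNESS-g1 §5 (N1). -/
theorem foolingMeasure_false_for_sparseHalf :
    ¬ ∃ ε : ℝ, 0 < ε ∧ ε ≤ 1 / 4 ∧ ∀ C : ℕ, ∃ᶠ n in Filter.atTop, ∃ μ : Finset (Sym2 (Fin n)) → ℝ,
      (∀ S, 0 ≤ μ S) ∧ (∑ S, μ S = 1) ∧
      (∀ S, μ S ≠ 0 → (∀ e ∈ S, ¬ e.IsDiag) ∧
        ¬ (SimpleGraph.fromEdgeSet (S : Set (Sym2 (Fin n)))).Colorable 3) ∧
      (∀ S, μ S ≠ 0 → ∃ B : Finset (Fin n), (1 / 2 - ε) * (n : ℝ) ≤ B.card ∧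
        (B.card : ℝ) ≤ (1 / 2 + ε) * n ∧ 4 * ((bobSide B S).card + 1) ≤ n) ∧
      ∀ B : Finset (Fin n), (1 / 2 - ε) * (n : ℝ) ≤ B.card → (B.card : ℝ) ≤ (1 / 2 + ε) * n →
        ∀ 𝓐 𝓑 : Finset (Finset (Sym2 (Fin n))),
          (∀ α ∈ 𝓐, ∀ e ∈ α, ¬ e.IsDiag ∧ ∃ v ∈ e, v ∉ B) →
          (∀ β ∈ 𝓑, ∀ e ∈ β, ¬ e.IsDiag ∧ ∀ v ∈ e, v ∈ B) →
          (∀ α ∈ 𝓐, ∀ β ∈ 𝓑,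
            ¬ (SimpleGraph.fromEdgeSet ((α ∪ β : Finset (Sym2 (Fin n))) : Set (Sym2 (Fin n)))).Colorable 3) →
          ∑ q ∈ 𝓐 ×ˢ 𝓑, μ (q.1 ∪ q.2) ≤ (2 : ℝ) ^ (-((n : ℝ) / 2 * Real.logb 2 n) - (C : ℝ) * n) := by
  rintro ⟨ε, hε0, -, hC⟩
  obtain ⟨n, hn4, μ, hμ, hsum, hs, hrestr, hX⟩ := Filter.frequently_atTop.1 (hC 1) 4
  set δ : ℝ := (2 : ℝ) ^ (-((n : ℝ) / 2 * Real.logb 2 n) - ((1 : ℕ) : ℝ) * n) with hδ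
  have hδpos : 0 < δ := Real.rpow_pos_of_pos (by norm_num) _
  set m : ℕ := n / 4 - 1 with hm
  have hm4 : 4 * (m + 1) ≤ n := by omega
  have hrestr' : ∀ S, μ S ≠ 0 → ∃ B : Finset (Fin n),
      ((1 / 2 - ε) * (n : ℝ) ≤ B.card ∧ (B.card : ℝ) ≤ (1 / 2 + ε) * n) ∧ (bobSide B S).card ≤ m := by
    intro S hS
    obtain ⟨B, h1, h2, hc⟩ := hrestr S hS
    exact ⟨B, ⟨h1, h2⟩, by omega⟩
  have htot := total_le_of_sparseHalf μ hμ hs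
    (fun B : Finset (Fin n) => (1 / 2 - ε) * (n : ℝ) ≤ B.card ∧ (B.card : ℝ) ≤ (1 / 2 + ε) * n)
    hδpos.le (fun B hB => hX B hB.1 hB.2) m hrestr'
  rw [hsum, Fintype.card_fin] at htot
  -- 2^n · δ = 2^{-(n/2) log₂ n}
  have h2n : ((2 ^ n : ℕ) : ℝ) * δ = (2 : ℝ) ^ (-((n : ℝ) / 2 * Real.logb 2 n)) := by
    have hneg : (2 : ℝ) ^ (-(n : ℝ)) = ((2 : ℝ) ^ n)⁻¹ := by
      rw [Real.rpow_neg (by norm_num : (0 : ℝ) ≤ 2), Real.rpow_natCast]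
    rw [hδ, Nat.cast_one, one_mul, sub_eq_add_neg, Real.rpow_add (by norm_num), hneg]
    have h2 : (2 : ℝ) ^ n ≠ 0 := by positivity
    push_cast
    field_simp
  have hcard := card_small_edgeSets_le (show 1 ≤ n by omega) m
  have hlt := count_mul_threshold_lt_one hn4 hm4
  have hpos : (0 : ℝ) < (2 : ℝ) ^ (-((n : ℝ) / 2 * Real.logb 2 n)) := Real.rpow_pos_of_pos (by norm_num) _
  -- 1 ≤ 2^n · (#P · δ) = #P · 2^{-(n/2) log₂ n} ≤ (m+1)(n²)^m · 2^{-(n/2) log₂ n} < 1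
  have hrew : ((2 ^ n : ℕ) : ℝ) *
      ((((univ : Finset (Finset (Sym2 (Fin n)))).filter (fun H => H.card ≤ m)).card : ℝ) * δ) =
      (((univ : Finset (Finset (Sym2 (Fin n)))).filter (fun H => H.card ≤ m)).card : ℝ) *
        (2 : ℝ) ^ (-((n : ℝ) / 2 * Real.logb 2 n)) := by
    rw [← h2n]; ring
  rw [hrew] at htot
  have := mul_le_mul_of_nonneg_right hcard hpos.le
  linarith

/-- **Independent near-halves cannot be fooled.**  X1 restricted to measures each of whose support graphs
has an INDEPENDENT near-balanced vertex set (no edge inside some `B` of X1's window — in particular every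
measure supported on graphs with independence number `≥ (1/2 - ε)·n`) is FALSE — the case `|G[B]| = 0` of
`foolingMeasure_false_for_sparseHalf` (equivalently: the one-rectangle cover "Alice's part is already
non-3-colourable" at the `≤ 2^n` cuts).  Every X1 support graph has independence number `< (1/2 - ε)·n`. -/
theorem foolingMeasure_false_for_independentHalf :
    ¬ ∃ ε : ℝ, 0 < ε ∧ ε ≤ 1 / 4 ∧ ∀ C : ℕ, ∃ᶠ n in Filter.atTop, ∃ μ : Finset (Sym2 (Fin n)) → ℝ,
      (∀ S, 0 ≤ μ S) ∧ (∑ S, μ S = 1) ∧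
      (∀ S, μ S ≠ 0 → (∀ e ∈ S, ¬ e.IsDiag) ∧
        ¬ (SimpleGraph.fromEdgeSet (S : Set (Sym2 (Fin n)))).Colorable 3) ∧
      (∀ S, μ S ≠ 0 → ∃ B : Finset (Fin n), (1 / 2 - ε) * (n : ℝ) ≤ B.card ∧
        (B.card : ℝ) ≤ (1 / 2 + ε) * n ∧ ∀ e ∈ S, ∃ v ∈ e, v ∉ B) ∧
      ∀ B : Finset (Fin n), (1 / 2 - ε) * (n : ℝ) ≤ B.card → (B.card : ℝ) ≤ (1 / 2 + ε) * n →
        ∀ 𝓐 𝓑 : Finset (Finset (Sym2 (Fin n))),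
          (∀ α ∈ 𝓐, ∀ e ∈ α, ¬ e.IsDiag ∧ ∃ v ∈ e, v ∉ B) →
          (∀ β ∈ 𝓑, ∀ e ∈ β, ¬ e.IsDiag ∧ ∀ v ∈ e, v ∈ B) →
          (∀ α ∈ 𝓐, ∀ β ∈ 𝓑,
            ¬ (SimpleGraph.fromEdgeSet ((α ∪ β : Finset (Sym2 (Fin n))) : Set (Sym2 (Fin n)))).Colorable 3) →
          ∑ q ∈ 𝓐 ×ˢ 𝓑, μ (q.1 ∪ q.2) ≤ (2 : ℝ) ^ (-((n : ℝ) / 2 * Real.logb 2 n) - (C : ℝ) * n) := by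
  rintro ⟨ε, hε0, hε1, hC⟩
  apply foolingMeasure_false_for_sparseHalf
  refine ⟨ε, hε0, hε1, fun C => Filter.frequently_atTop.2 fun a => ?_⟩
  obtain ⟨n, hn, μ, hμ, hsum, hs, hind, hX⟩ := Filter.frequently_atTop.1 (hC C) (max a 4)
  refine ⟨n, le_trans (le_max_left _ _) hn, μ, hμ, hsum, hs, ?_, hX⟩
  intro S hS
  obtain ⟨B, h1, h2, hB⟩ := hind S hS
  refine ⟨B, h1, h2, ?_⟩
  have hempty : bobSide B S = ∅ := by
    refine eq_empty_of_forall_notMem fun e he => ?_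
    obtain ⟨heS, hin⟩ := mem_bobSide.1 he
    obtain ⟨v, hv, hvB⟩ := hB e heS
    exact hvB (hin v hv)
  rw [hempty, card_empty]
  have h4 : 4 ≤ n := le_trans (le_max_right _ _) hn
  omega

end Summit.PneNP.PneNP.Theorems.AeaCutRectanglesNoSparseSupports
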